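import Summits.QuantumFields.BalabanUV.Beta.GAN24.MonotoneTorusTower
import Summits.QuantumFields.BalabanUV.Beta.GAN24.MonotoneCritical
import Summits.QuantumFields.BalabanUV.Beta.GAN24.MonotoneLimit

/-!
# Beta / GAN24 / MonotoneTorusPlaquette — UNCONDITIONAL: the covariance of the PLAQUETTE (field-strength) observables of Bałaban's
# sub-block-averaged, block-constrained fluctuation field DECREASES in the Loewner order under every refinement step — on every torus,
# in every dimension, for every averaging factor `Lc`, every constraint matrix on the read-out lattice, with NO gauge fixing, NO rate, NO
# constant and NO hypothesis left (finding (N1) of the gen-2 diagnostic `LOEWNER-DIAG.md`, torus avatar, as a theorem)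
# (gan24-p4 gen 3; SKELETON-P4 nodes N2–N5 closed on the torus for co-exact test forms; BINDER-OWNERS row G-an2-4 ∕ (CONV-C), ALTERNATIVE
# DISCHARGE «rate OR monotonicity»; NOT IN PRINT — our proof attempt)

HONEST FRAMING (page 1 of everything the β sub-cell writes): discharging `BetaPertH` makes Bałaban's UV stability UNCONDITIONAL — a
real constructive-QFT result; it is NOT the continuum limit and NOT the Clay problem.  HONEST DEPENDENCY (cell reorg 2026-08-19, verbatim):
«continuum YM on T⁴ ⇐ BetaPertH ∧ nine spine estimates (0/9 proved); BetaPertH ⇐ (D1) ∧ (D4) ∧ CAP+tail; G-an2-4 gates asym, D1 and NE2/3/4.»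
HONEST LABEL: «not in print; our proof attempt; alternative discharge of the G-an2-4 row (rate OR monotonicity)»; 0 wall binders instantiated.
ABSOLUTE RULE honoured: nothing cited; the inputs are TREE THEOREMS BY NAME — `B5AverageCurlStokes.plaq_QvOp` («plaquette of the average =
average of the squares», kernel-proved there), and through `GAN24/MonotoneTorusTower`: Federbush's stability `sum_normSq_plaq_QvOp_le` and the
composition law `B5Composition116.QvOp_comp`; the covariance is the gauge-free canonical one of `GAN24/MonotoneCritical`.  [folklore] otherwise.

## THE POINT
`MonotoneTorusTower.readOut_chain_torus` leaves ONE hypothesis: the read sources must admit CRITICAL covariance columns, i.e.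
(`MonotoneCritical.isCrit_critCov` ∕ `orth_zeroModes_of_isCrit`) be orthogonal to the constrained CURL-FREE fields.  For the test forms
`t = curlMatᴴ F` — reading the PLAQUETTE VARIABLES `plaq M (Q_{Lc^j} A) μ ν y` of the sub-block-averaged field — this is AUTOMATIC: a curl-free
fine field has curl-free block averages (`plaq_QvOp`: the coarse plaquette is an average of fine Wilson loops, each a sum of fine plaquettes), so
`⟨z, (curlMat * sread j)ᴴ F⟩ = ⟨curlMat (sread j z), F⟩ = 0`.  No discrete Poincaré lemma, no condition on the constraint rows.

## WHAT IS PROVED (read-out torus `Tor M`, `Lc ≥ 1`, any `d`, any constraint matrix `R` on the read-out 1-forms)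
* §1 `curlEnergy_eq_zero_iff`, `plaq_eq_zero_of_hform_mulVec` (null vectors of `hform j` are the curl-free fields), `plaq_sread_eq_zero`
  (curl-free ⟹ curl-free averages, `plaq_QvOp` BY NAME), `plaquette_source_legit`.
* §2 `plaqCov R j := (curlMat M * sread j) * critCov (hform j) (rows R j) * (curlMat M * sread j)ᴴ` — the canonical covariance matrix of the
  read-out plaquette observables of the level-`j` field under the hard constraints `rows R j` (value of the Gaussian variational problem; equal to
  the read-out of the KKT covariance of ANY legitimate gauge slice: `plaqCov_quad_eq_of_isCrit`).
* §3 **`plaqCov_antitone_step : (plaqCov R j − plaqCov R (j+1)).PosSemidef`** for EVERY `j` — hypothesis-free; `plaqCov_posSemidef`;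
  **`plaqCov_entry_dev_le`**: ONE trace datum `re tr (plaqCov R k₀ − plaqCov R j) ≤ η₀` (`j ≥ k₀`) ⟹ every entry of `plaqCov R j − plaqCov R j'`
  (`j, j' ≥ k₀`) has norm `≤ η₀` and `re tr plaqCov R j` is `MonotoneTailDown` — (MONO-K)₂ for the plaquette block, NO rate.
SCOPE (honest): torus avatar in B5's typing; abelian ∕ linearised (`U = 1`) layer; the plaquette (co-exact) test forms only — harmonic (constant)
and pure-gauge test forms are not covered here; no identification with an2's `ℤ^{d+1}` wall system; NOT BetaPertH, NOT continuum, NOT Clay.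
-/

namespace Summit.QuantumFields.BalabanUV.Beta.GAN24.MonotoneTorusPlaquette

open Matrix Finset
open scoped BigOperators ComplexOrder ComplexConjugate
open Literature.MathematicalPhysics.QuantumFieldTheory.Balaban1983to89
open Literature.MathematicalPhysics.QuantumFieldTheory.Balaban1983to89.B5Prop11Plancherel (Tor fine unitVec)
open Literature.MathematicalPhysics.QuantumFieldTheory.Balaban1983to89.B5Block118 (QvOp)
open Literature.MathematicalPhysics.QuantumFieldTheory.Balaban1983to89.B5AverageCurlStokes (plaq plaq_apply squareSum plaq_QvOp)
open Summit.QuantumFields.BalabanUV.Beta.GAN24.MonotoneCoarsen (IsCrit conj_pairing pairing_eq_of_isCrit)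
open Summit.QuantumFields.BalabanUV.Beta.GAN24.MonotoneCritical (critCov critCov_conjTranspose isCrit_critCov pairing_eq_critCov)
open Summit.QuantumFields.BalabanUV.Beta.GAN24.MonotoneTorusTower (curlMat curlMat_mulVec curlEnergy curlEnergy_nonneg Lev sread cstep rows
  scal scal_nonneg hform hform_quad hform_isHermitian hform_posSemidef readOut_chain_torus readOut_entry_dev_le_torus)
open Summit.QuantumFields.BalabanUV.Beta.CapRowsTail (MonotoneTailDown)

variable {d : ℕ}

/-! ## §1 Curl-free fields: the null vectors of `hform j`, and their averages -/

section CurlFree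

variable (N : Fin d → ℕ) [hN : ∀ μ, NeZero (N μ)]

/-- `curlEnergy A = 0` iff every plaquette variable of `A` vanishes. [folklore] -/
theorem curlEnergy_eq_zero_iff (A : Tor N × Fin d → ℂ) : curlEnergy N A = 0 ↔ ∀ μ ν x, plaq N A μ ν x = 0 := by
  unfold curlEnergy
  rw [Finset.sum_eq_zero_iff_of_nonneg fun _ _ => by positivity]
  simp only [Finset.mem_univ, forall_true_left]
  refine forall_congr' fun μ => ?_
  rw [Finset.sum_eq_zero_iff_of_nonneg fun _ _ => by positivity]
  simp only [Finset.mem_univ, forall_true_left]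
  refine forall_congr' fun ν => ?_
  rw [Finset.sum_eq_zero_iff_of_nonneg fun _ _ => by positivity]
  simp only [Finset.mem_univ, forall_true_left, sq_eq_zero_iff, norm_eq_zero]

variable (Lc : ℕ) [NeZero Lc] (M : Fin d → ℕ) [hM : ∀ μ, NeZero (M μ)]

omit [NeZero Lc] in
/-- `scal j > 0` for `Lc ≥ 1`. [folklore] -/
theorem scal_pos (hL : 0 < Lc) (j : ℕ) : 0 < scal (d := d) Lc j := by
  unfold scal
  have : (0 : ℝ) < Lc := by exact_mod_cast hL
  positivity

/-- **THE NULL VECTORS OF `hform j` ARE THE CURL-FREE FIELDS**: `hform j z = 0 ⟹ plaq z ≡ 0`. [folklore] -/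
theorem plaq_eq_zero_of_hform_mulVec (j : ℕ) (z : Lev Lc M j → ℂ) (hz : hform Lc M j *ᵥ z = 0) (μ ν : Fin d)
    (x : Tor (fine (Lc ^ j) M)) : plaq (fine (Lc ^ j) M) z μ ν x = 0 := by
  have hL : 0 < Lc := Nat.pos_of_ne_zero (NeZero.ne Lc)
  have h1 : star z ⬝ᵥ (hform Lc M j *ᵥ z) = 0 := by rw [hz, dotProduct_zero]
  rw [hform_quad] at h1
  have h2 : scal (d := d) Lc j * curlEnergy (fine (Lc ^ j) M) z = 0 := by exact_mod_cast h1
  have h3 : curlEnergy (fine (Lc ^ j) M) z = 0 := by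
    rcases mul_eq_zero.mp h2 with h | h
    · exact absurd h (scal_pos Lc hL j).ne'
    · exact h
  exact (curlEnergy_eq_zero_iff _ z).mp h3 μ ν x

/-- **CURL-FREE FIELDS HAVE CURL-FREE BLOCK AVERAGES**: `plaq z ≡ 0 ⟹ plaq (sread j z) ≡ 0` — the tree's `B5AverageCurlStokes.plaq_QvOp`
(the coarse plaquette of `Q_k A` is an average of fine Wilson loops, each the sum of the fine plaquettes it encloses) BY NAME. [folklore] -/
theorem plaq_sread_eq_zero (j : ℕ) (z : Lev Lc M j → ℂ) (hz : ∀ μ ν x, plaq (fine (Lc ^ j) M) z μ ν x = 0) (μ ν : Fin d)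
    (y : Tor M) : plaq M (sread Lc M j *ᵥ z) μ ν y = 0 := by
  unfold sread
  rw [plaq_QvOp]
  simp only [squareSum, hz, Finset.sum_const_zero, mul_zero]

/-- The plaquette read-out of a curl-free field vanishes: `curlMat M (sread j z) = 0`. [folklore] -/
theorem curlMat_sread_mulVec_eq_zero (j : ℕ) (z : Lev Lc M j → ℂ) (hz : hform Lc M j *ᵥ z = 0) :
    curlMat M *ᵥ (sread Lc M j *ᵥ z) = 0 := by
  funext r
  obtain ⟨μ, ν, y⟩ := r
  rw [curlMat_mulVec, Pi.zero_apply]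
  exact plaq_sread_eq_zero Lc M j z (plaq_eq_zero_of_hform_mulVec Lc M j z hz) μ ν y

/-- **PLAQUETTE TEST FORMS ARE LEGITIMATE SOURCES**: every null vector `z` of `hform j` (constrained or not) is orthogonal to every read source
`(curlMat M * sread j)ᴴ F`. [folklore] -/
theorem plaquette_source_legit (j : ℕ) (F : Fin d × Fin d × Tor M → ℂ) (z : Lev Lc M j → ℂ) (hz : hform Lc M j *ᵥ z = 0) :
    star z ⬝ᵥ ((curlMat M * sread Lc M j)ᴴ *ᵥ F) = 0 := by
  rw [← conj_pairing, ← mulVec_mulVec, curlMat_sread_mulVec_eq_zero Lc M j z hz, star_zero, zero_dotProduct]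

end CurlFree

/-! ## §2 The canonical plaquette covariance of the block-constrained field -/

section PlaqCov

variable (Lc : ℕ) [NeZero Lc] (M : Fin d → ℕ) [hM : ∀ μ, NeZero (M μ)]
variable {c : Type*} [Fintype c] [DecidableEq c]

/-- **THE PLAQUETTE COVARIANCE AT LEVEL `j`**: the read-out, through the plaquette variables of the sub-block averages (1.18), of the canonical
constrained covariance (`MonotoneCritical.critCov`, no gauge fixing) of the curl energy `hform j` under the hard rows `rows R j`. [folklore] -/
noncomputable def plaqCov (R : Matrix c (Tor M × Fin d) ℂ) (j : ℕ) : Matrix (Fin d × Fin d × Tor M) (Fin d × Fin d × Tor M) ℂ :=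
  (curlMat M * sread Lc M j) * critCov (hform_isHermitian Lc M j) (rows Lc M R j) * (curlMat M * sread Lc M j)ᴴ

/-- The columns of the canonical covariance at the plaquette sources are critical on the gauge-free constraint space. [folklore] -/
theorem isCrit_plaquette_column (R : Matrix c (Tor M × Fin d) ℂ) (j : ℕ) (F : Fin d × Fin d × Tor M → ℂ) :
    IsCrit (hform Lc M j) ((curlMat M * sread Lc M j)ᴴ *ᵥ F) (LinearMap.ker (rows Lc M R j).mulVecLin)
      (critCov (hform_isHermitian Lc M j) (rows Lc M R j) *ᵥ ((curlMat M * sread Lc M j)ᴴ *ᵥ F)) :=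
  isCrit_critCov (hform_posSemidef Lc M j) (rows Lc M R j) fun z _ hzH => plaquette_source_legit Lc M j F z hzH

/-- **GAUGE∕SLICE INDEPENDENCE OF THE PLAQUETTE COVARIANCE**: for ANY family of covariance columns `v` critical at the plaquette sources on
`ker (rows R j)` (e.g. the KKT columns of any legitimate gauge fixing of the constrained Gaussian), the variance of every plaquette observable
combination `F` agrees with `plaqCov`: `⟨(C S)ᴴF, v⟩ = ⟨F, plaqCov R j F⟩`. [folklore] -/
theorem plaqCov_quad_eq_of_isCrit (R : Matrix c (Tor M × Fin d) ℂ) (j : ℕ) (F : Fin d × Fin d × Tor M → ℂ) {v : Lev Lc M j → ℂ}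
    (hv : IsCrit (hform Lc M j) ((curlMat M * sread Lc M j)ᴴ *ᵥ F) (LinearMap.ker (rows Lc M R j).mulVecLin) v) :
    star ((curlMat M * sread Lc M j)ᴴ *ᵥ F) ⬝ᵥ v = star F ⬝ᵥ (plaqCov Lc M R j *ᵥ F) := by
  rw [pairing_eq_critCov (hform_posSemidef Lc M j) (rows Lc M R j) hv, plaqCov, ← mulVec_mulVec, ← mulVec_mulVec, conj_pairing,
    conjTranspose_conjTranspose]

end PlaqCov

/-! ## §3 The unconditional chain and (MONO-K)₂ for the plaquette block -/

section Chain

variable (Lc : ℕ) [NeZero Lc] (M : Fin d → ℕ) [hM : ∀ μ, NeZero (M μ)]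
variable {c : Type*} [Fintype c] [DecidableEq c]

/-- **UNCONDITIONAL LOEWNER MONOTONICITY OF THE PLAQUETTE COVARIANCE UNDER REFINEMENT.**  For every read-out torus `Tor M`, every averaging factor
`Lc ≥ 1`, every dimension, every constraint matrix `R` on the read-out 1-forms and every level `j`:
`(plaqCov R j − plaqCov R (j+1)).PosSemidef` — one more Bałaban averaging step (a finer lattice below the same read-out) can only DECREASE the
covariance of the plaquette observables of the block-constrained fluctuation field.  Federbush's stability + (1.17) + the variational principle;
no rate, no constant, no gauge fixing, no hypothesis. [folklore] -/
theorem plaqCov_antitone_step (R : Matrix c (Tor M × Fin d) ℂ) (j : ℕ) :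
    (plaqCov Lc M R j - plaqCov Lc M R (j + 1)).PosSemidef :=
  readOut_chain_torus Lc M (curlMat M) R (fun j => critCov (hform_isHermitian Lc M j) (rows Lc M R j))
    (fun _ => critCov_conjTranspose _ _) (fun j F => isCrit_plaquette_column Lc M R j F) j

/-- The chain over several steps: `plaqCov R j' ≤ plaqCov R j` for `j ≤ j'`. [folklore] -/
theorem plaqCov_antitone {R : Matrix c (Tor M × Fin d) ℂ} {j j' : ℕ} (h : j ≤ j') :
    (plaqCov Lc M R j - plaqCov Lc M R j').PosSemidef := by
  induction h with
  | refl => rw [sub_self]; exact PosSemidef.zero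
  | @step m _ ih =>
    have h2 := plaqCov_antitone_step Lc M R m
    have e : ∀ (a b c : Matrix (Fin d × Fin d × Tor M) (Fin d × Fin d × Tor M) ℂ), a - c = (a - b) + (b - c) := fun a b c => by abel
    rw [e _ (plaqCov Lc M R m) _]
    exact ih.add h2

/-- `plaqCov R j` is positive semidefinite (a covariance): its quadratic form at `F` is the pairing `⟨r, Γ r⟩ = ⟨Γ r, H Γ r⟩ ≥ 0` of a critical
column. [folklore] -/
theorem plaqCov_posSemidef (R : Matrix c (Tor M × Fin d) ℂ) (j : ℕ) : (plaqCov Lc M R j).PosSemidef := by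
  have hH : (plaqCov Lc M R j).IsHermitian := by
    unfold plaqCov
    exact Matrix.isHermitian_mul_mul_conjTranspose _ (MonotoneCritical.critCov_isHermitian _ _)
  refine PosSemidef.of_dotProduct_mulVec_nonneg hH fun F => ?_
  have hc := isCrit_plaquette_column Lc M R j F
  set r := (curlMat M * sread Lc M j)ᴴ *ᵥ F
  set v := critCov (hform_isHermitian Lc M j) (rows Lc M R j) *ᵥ r
  -- `⟨F, P F⟩ = ⟨r, v⟩` and criticality at `w = v` gives `⟨v, r⟩ = ⟨v, H v⟩ ≥ 0`
  have e1 : star F ⬝ᵥ (plaqCov Lc M R j *ᵥ F) = star r ⬝ᵥ v := (plaqCov_quad_eq_of_isCrit Lc M R j F hc).symm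
  have e2 : star v ⬝ᵥ r = star v ⬝ᵥ (hform Lc M j *ᵥ v) := by
    have h := hc.2 v hc.1
    rwa [dotProduct_sub, sub_eq_zero] at h
  have e3 : star r ⬝ᵥ v = star v ⬝ᵥ (hform Lc M j *ᵥ v) := by
    calc star r ⬝ᵥ v = star (star v ⬝ᵥ r) := star_dotProduct r v
      _ = star (star v ⬝ᵥ (hform Lc M j *ᵥ v)) := by rw [e2]
      _ = star (hform Lc M j *ᵥ v) ⬝ᵥ v := (star_dotProduct (hform Lc M j *ᵥ v) v).symm
      _ = star v ⬝ᵥ ((hform Lc M j)ᴴ *ᵥ v) := conj_pairing (hform Lc M j) v v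
      _ = star v ⬝ᵥ (hform Lc M j *ᵥ v) := by rw [(hform_isHermitian Lc M j).eq]
  rw [e1, e3]
  exact (hform_posSemidef Lc M j).dotProduct_mulVec_nonneg v

/-- **(MONO-K)₂ FOR THE PLAQUETTE BLOCK FROM ONE TRACE DATUM — NO RATE.**  ONE number `η₀` with `re tr (plaqCov R k₀ − plaqCov R j) ≤ η₀` for all
`j ≥ k₀` (a computation at level `k₀` against the monotone limit) bounds EVERY entry of `plaqCov R j − plaqCov R j'`, `j, j' ≥ k₀`, by `η₀`, and
`j ↦ re tr plaqCov R j` is an5's `MonotoneTailDown`. [folklore] -/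
theorem plaqCov_entry_dev_le (R : Matrix c (Tor M × Fin d) ℂ) {k₀ : ℕ} {η₀ : ℝ}
    (hdat : ∀ j, k₀ ≤ j → (plaqCov Lc M R k₀ - plaqCov Lc M R j).trace.re ≤ η₀) :
    (∀ j j', k₀ ≤ j → k₀ ≤ j' → ∀ a b, ‖(plaqCov Lc M R j - plaqCov Lc M R j') a b‖ ≤ η₀) ∧
      MonotoneTailDown (fun j => (plaqCov Lc M R j).trace.re) k₀ :=
  readOut_entry_dev_le_torus Lc M (curlMat M) R (fun j => critCov (hform_isHermitian Lc M j) (rows Lc M R j))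
    (fun _ => critCov_conjTranspose _ _) (fun j F => isCrit_plaquette_column Lc M R j F) hdat

end Chain


/-! ## §4 (v1.1, append-only + one import) THE LIMIT `j → ∞` OF THE PLAQUETTE COVARIANCES EXISTS — by monotonicity alone (gen 1's `MonotoneLimit` BY NAME) -/

section Limit

open Filter Topology
open Summit.QuantumFields.BalabanUV.Beta.GAN24.MonotoneLimit (exists_tendsto_apply_of_steps norm_sub_lim_apply_le_of_steps
  tendsto_re_diag_shift antitone_re_diag_shift)

variable (Lc : ℕ) [NeZero Lc] (M : Fin d → ℕ) [hM : ∀ μ, NeZero (M μ)]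
variable {c : Type*} [Fintype c] [DecidableEq c]

/-- **THE REFINEMENT LIMIT OF THE PLAQUETTE COVARIANCES EXISTS, UNCONDITIONALLY.**  For every read-out torus, `Lc ≥ 1`, `d` and constraint matrix
`R`, the entries of `plaqCov R j` converge as `j → ∞` (the lattice below the fixed read-out torus becoming infinitely fine): an antitone chain of
positive semidefinite matrices converges (gen 1's `MonotoneLimit.exists_tendsto_apply_of_steps`).  No rate, no estimate — existence only; the
identification of the limit with a continuum object is NOT claimed. [folklore] -/
theorem exists_plaqCov_limit (R : Matrix c (Tor M × Fin d) ℂ) :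
    ∃ Pinf : Matrix (Fin d × Fin d × Tor M) (Fin d × Fin d × Tor M) ℂ,
      ∀ a b, Tendsto (fun j => plaqCov Lc M R j a b) atTop (𝓝 (Pinf a b)) :=
  exists_tendsto_apply_of_steps (P := fun j => plaqCov Lc M R j) (k₀ := 0) (fun j _ => plaqCov_antitone_step Lc M R j)
    (fun j _ => plaqCov_posSemidef Lc M R j)

/-- The diagonal entries (variances of single plaquette observables) decrease to their limits: `j ↦ re (plaqCov R j a a)` is antitone. [folklore] -/
theorem plaqCov_diag_antitone (R : Matrix c (Tor M × Fin d) ℂ) (a : Fin d × Fin d × Tor M) :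
    Antitone fun j : ℕ => (plaqCov Lc M R j a a).re := by
  have h := antitone_re_diag_shift (P := fun j => plaqCov Lc M R j) (k₀ := 0) (fun j _ => plaqCov_antitone_step Lc M R j) a
  simpa only [Nat.zero_add] using h

/-- **BAND TO THE LIMIT FROM ONE DATUM**: with the limit `Pinf` of `exists_plaqCov_limit` and ONE number `η₀ ≥ re tr (plaqCov R k₀ − plaqCov R j)` for all
`j ≥ k₀`, every entry of `plaqCov R j − Pinf`, `j ≥ k₀`, has norm `≤ η₀` (gen 1's `MonotoneLimit.norm_sub_lim_apply_le_of_steps`). [folklore] -/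
theorem plaqCov_sub_limit_le (R : Matrix c (Tor M × Fin d) ℂ) {k₀ : ℕ} {η₀ : ℝ}
    (hdat : ∀ j, k₀ ≤ j → (plaqCov Lc M R k₀ - plaqCov Lc M R j).trace.re ≤ η₀)
    {Pinf : Matrix (Fin d × Fin d × Tor M) (Fin d × Fin d × Tor M) ℂ} (hlim : ∀ a b, Tendsto (fun j => plaqCov Lc M R j a b) atTop (𝓝 (Pinf a b))) :
    ∀ j, k₀ ≤ j → ∀ a b, ‖(plaqCov Lc M R j - Pinf) a b‖ ≤ η₀ :=
  norm_sub_lim_apply_le_of_steps (P := fun j => plaqCov Lc M R j) (fun j _ => plaqCov_antitone_step Lc M R j) hdat hlim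

end Limit

end Summit.QuantumFields.BalabanUV.Beta.GAN24.MonotoneTorusPlaquette
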